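import Summits.QuantumFields.YangMills.Theorems.FluctuationComparisonRegPrIntLS2BetaBackgroundTower
import Summits.QuantumFields.YangMills.Theorems.FluctuationComparisonRegPrIntLS2BetaBackgroundLetterOfThm1Pair
import Summits.QuantumFields.YangMills.Theorems.FluctuationComparisonRegPrIntLS2BetaThresholdSum
import HarnessLib

/-!
# S2β · the (D-stage) REL-TEL road — BKG-TOWER IN THE LETTERS' PREFIX: px5 g22's (BKG) letter ✓p822405 (`dist1 U₀(∂p) ≤ C₁·θ_J·L^{−2(K−J)}` at the finest
# level) ⟹ the same at EVERY height of the background tower, `dist1 (M^tU₀)(∂p) ≤ 2C₁·θ_J·L^{2t}·L^{−2(K−J)}` (`t ≤ K − J`), for `γ ≤ γ₁` — the SIZE row of (H♭♭)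

Cell `ym3-torus` (rung R3 = continuum `SU(2)` Yang–Mills on T³ — NOT d = 4, NOT infinite volume, NOT a mass gap, NOT Clay).  Width seat «width 12» `ym3-torus-px12`
(gen 24); `--kind proof --supports stmt-QuantumFields-20520 --as helper`, count-neutral, DEFINITION-FREE (0 `def`∕`instance`∕`notation`∕`sorry`).

WHAT.  ★★★ `bkgTower_of_bkgLetter (G) (hBkg)` : the (BKG) letter in px16∕px5's prefix (guard `G` arbitrary; = ✓p822405 `bkgLetter_of_thm1Pair`'s conclusion, i.e. the
`hBkg` input of ✓`pairingLetter_of_critPair`∕`pairingAx_of_critAx`) ⟹ the BKG-TOWER letter in the SAME prefix with `C₁ ↦ 2C₁`: for every argmin `U₀` and every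
height `t ≤ K − J`, `dist1 (M^tU₀)(∂p) ≤ 2C₁·θBal_J·L^{2t}·L^{−2(K−J)}`.  Proof: ✓`…BackgroundTower.dist1_plaqHol_iter_le` with `a₀ := C₁θ_J·L^{−2(K−J)}` — its two
guards read `a₀·L^{2(K−J)} = C₁θ_J ≤ c(L)` DEPTH-FREE, granted for `γ ≤ γ₁` by ✓`thresholdSum_small` (`θBal ≤ a₀(L, C₁)`).  So with px5's ✓`bkgLetter_body_five` the
tower letter holds OUTRIGHT at every `L ≥ 5`, and modulo the `L = 3` Thm-1 pair at `L = 3` (✓`bkgLetter_of_thm1PairAtThree`).  CONSUMER: the `W j u` row of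
✓p824471 `dStage_of_feedbackLetter`'s (H♭♭) (SIZE_u `∝ θ_J·L^{2u−2(K−J)}` ⟹ the feedback double sum is `O(θ_J)`, UV3-NODE §84.6 (3)(a)); px10 g23's FILE 6′∕7′
`PlaqSmall θ₀ U₀` at height `u`.

HONEST SCOPE.  Prefix plumbing + one threshold choice over two landed files; (BKG) is a HYPOTHESIS here (px5's lane discharges it); nothing of Bałaban's analysis
asserted ([Balaban1985Variational] Thm 1 (9) p.279; [Balaban1985Averaging] Prop. 1 (51) p.26); (H♭♭), (D-stage), GAP♯∘ (`stub_uniformFibreGapOrbit`), S2β, crux 20520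
and `YM3TorusSU2` NOT proved; no registered stub closed; rung R3 = SU(2) YM₃ on T³ — NOT d = 4, NOT infinite volume, NOT a mass gap, NOT Clay; the Yang–Mills mass
gap is NOT proved.
-/

set_option autoImplicit false

noncomputable section

namespace Summit.QuantumFields.YangMills.Theorems.FluctuationComparisonRegPrIntLS2BetaBackgroundTowerLetter

open Finset
open Literature.MathematicalPhysics.QuantumFieldTheory.Balaban1983to89
open T4Continuum T3ContinuumYM3Torus T3UnitScaleTilt T3TiltDescent T3LevelShift BlockAveraging ExpMeanLog
open T3UnitLawDensityEML (ℰp)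
open T3ConstrainedMinimiser (fibre)
open T3PrintedRegularMinimiser (minActionRegPr)
open Summit.QuantumFields.YangMills.Theorems.FluctuationComparisonRegPrIntLS2BetaBackgroundTower (dist1_plaqHol_iter_le)
open Summit.QuantumFields.YangMills.Theorems.FluctuationComparisonRegPrIntLS2BetaThresholdSum (thresholdSum_small)

/-- ★★★ **BKG-TOWER FROM (BKG)**: the background letter at the finest level ⟹ the background letter at EVERY height of the averaging tower, constant doubled.
[cite: Balaban1985Averaging, Prop. 1 (51) p.26; Balaban1985Variational, Thm 1 (9) p.279] -/
theorem bkgTower_of_bkgLetter (G : (F : T3Family) → (J : ℕ) → GaugeField (F.P J) 0 (Matrix.specialUnitaryGroup (Fin 2) ℂ) → Prop)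
    (hBkg : ∀ (L : ℕ), ∃ c₀ : ℝ, 0 < c₀ ∧ c₀ ≤ 1 ∧ ∀ (cw : ℝ), 0 < cw → cw ≤ c₀ → ∃ pS : ℝ, ∀ (b₀ p₀ : ℝ), 0 < b₀ → pS ≤ p₀ → 0 < p₀ → ∃ ε₁ : ℝ, 0 < ε₁ ∧ ∀ (ε₀ : ℝ), 0 < ε₀ → ε₀ ≤ ε₁ →
    ∃ γ₁ : ℝ, 0 < γ₁ ∧ ∃ C₁ : ℝ, 0 ≤ C₁ ∧ ∀ (F : T3Family) (γ : ℝ), F.L = L → 0 < γ → γ ≤ γ₁ →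
      ∀ (J K : ℕ) (hJK : J ≤ K) (V : GaugeField (F.P J) 0 (Matrix.specialUnitaryGroup (Fin 2) ℂ)), PlaqSmall (θBal F.L γ (cw * b₀) p₀ J) V →
        G F J V →
        ∀ U₀ ∈ {U' : GaugeField (F.P K) 0 (Matrix.specialUnitaryGroup (Fin 2) ℂ) | U' ∈ fibre F ℰp J K hJK V ∧ U' ∈ histGood F ℰp (θBal F.L γ b₀ p₀) K J ∧
            wilsonAction4 U' = minActionRegPr F J K hJK ε₀ V},
        ∀ p : Plaq (F.P K) 0, dist1 (GaugeField.plaqHol U₀ p) ≤ C₁ * θBal F.L γ b₀ p₀ J * ((F.L : ℝ)⁻¹) ^ (2 * (K - J))) :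
    ∀ (L : ℕ), ∃ c₀ : ℝ, 0 < c₀ ∧ c₀ ≤ 1 ∧ ∀ (cw : ℝ), 0 < cw → cw ≤ c₀ → ∃ pS : ℝ, ∀ (b₀ p₀ : ℝ), 0 < b₀ → pS ≤ p₀ → 0 < p₀ → ∃ ε₁ : ℝ, 0 < ε₁ ∧ ∀ (ε₀ : ℝ), 0 < ε₀ → ε₀ ≤ ε₁ →
    ∃ γ₁ : ℝ, 0 < γ₁ ∧ ∃ C₁ : ℝ, 0 ≤ C₁ ∧ ∀ (F : T3Family) (γ : ℝ), F.L = L → 0 < γ → γ ≤ γ₁ →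
      ∀ (J K : ℕ) (hJK : J ≤ K) (V : GaugeField (F.P J) 0 (Matrix.specialUnitaryGroup (Fin 2) ℂ)), PlaqSmall (θBal F.L γ (cw * b₀) p₀ J) V →
        G F J V →
        ∀ U₀ ∈ {U' : GaugeField (F.P K) 0 (Matrix.specialUnitaryGroup (Fin 2) ℂ) | U' ∈ fibre F ℰp J K hJK V ∧ U' ∈ histGood F ℰp (θBal F.L γ b₀ p₀) K J ∧
            wilsonAction4 U' = minActionRegPr F J K hJK ε₀ V},
        ∀ t, t ≤ K - J → ∀ p : Plaq (F.P K) t,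
          dist1 (GaugeField.plaqHol (Averaging.iter (fun k => blockAvg (P := F.P K) (j := k) ℰp) t U₀) p) ≤
            C₁ * θBal F.L γ b₀ p₀ J * (F.L : ℝ) ^ (2 * t) * ((F.L : ℝ)⁻¹) ^ (2 * (K - J)) := by
  intro L
  obtain ⟨c₀, hc₀, hc₀1, H1⟩ := hBkg L
  refine ⟨c₀, hc₀, hc₀1, fun cw hcw hcwle => ?_⟩
  obtain ⟨pS, H1⟩ := H1 cw hcw hcwle
  refine ⟨pS, fun b₀ p₀ hb hpS hp => ?_⟩
  obtain ⟨ε₁, hε₁, H1⟩ := H1 b₀ p₀ hb hpS hp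
  refine ⟨ε₁, hε₁, fun ε₀ hε₀ hε₀le => ?_⟩
  obtain ⟨γ₁, hγ₁, C₁, hC₁, H1⟩ := H1 ε₀ hε₀ hε₀le
  by_cases hL : 1 < L
  · have hL' : (1 : ℝ) < L := by exact_mod_cast hL
    -- the block-size constants and the threshold `a₀(L, C₁)` making both guards of `dist1_plaqHol_iter_le` hold depth-free
    obtain ⟨Gc, hGc⟩ : ∃ x : ℝ, x = ((((3 + 4) * L : ℕ) : ℝ) ^ 2 / 4) := ⟨_, rfl⟩
    have hGc0 : 0 < Gc := by rw [hGc]; positivity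
    have hδ := ExpMeanLog.deltaSU_pos (n := Fin 2)
    have hL21 : 0 < (L : ℝ) ^ 2 - 1 := by nlinarith
    obtain ⟨a₀, ha₀⟩ : ∃ x : ℝ, x = min (((L : ℝ) ^ 2 - 1) / (4 * (143 * Gc ^ 2) * (C₁ + 1)))
        (ExpMeanLog.deltaSU (Fin 2) / 2 / (Gc * (2 * (C₁ + 1)))) := ⟨_, rfl⟩
    have ha₀0 : 0 < a₀ := by rw [ha₀]; exact lt_min (by positivity) (by positivity)
    obtain ⟨γ₂, hγ₂, hth⟩ := thresholdSum_small L hL b₀ p₀ hb hp 0 a₀ 1 le_rfl ha₀0 one_pos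
    refine ⟨min γ₁ γ₂, lt_min hγ₁ hγ₂, 2 * C₁, by positivity, fun F γ hFL hγ hγle J K hJK V hV hG U₀ hU₀ t ht p => ?_⟩
    have hγ1 : γ ≤ γ₁ := hγle.trans (min_le_left _ _)
    have hγ2 : γ ≤ γ₂ := hγle.trans (min_le_right _ _)
    have hFL' : (F.L : ℝ) = L := by exact_mod_cast hFL
    have hLF : 1 < (F.L : ℝ) := by rw [hFL']; exact hL'
    have hPd : (F.P K).d = 3 := rfl
    have hPL : (F.P K).L = F.L := rfl
    set θJ := θBal F.L γ b₀ p₀ J with hθJ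
    have hθ0 : 0 ≤ θJ := by rw [hθJ, hFL]; exact ((hth γ hγ hγ2).1 J).1
    have hθa : θJ ≤ a₀ := by rw [hθJ, hFL]; exact ((hth γ hγ hγ2).1 J).2
    -- (BKG) at the finest level
    have h0 : ∀ q : Plaq (F.P K) 0, dist1 (GaugeField.plaqHol U₀ q) ≤ C₁ * θJ * ((F.L : ℝ)⁻¹) ^ (2 * (K - J)) :=
      H1 F γ hFL hγ hγ1 J K hJK V hV hG U₀ hU₀
    have ha0' : 0 ≤ C₁ * θJ * ((F.L : ℝ)⁻¹) ^ (2 * (K - J)) := by positivity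
    -- `a₀·L^{2(K−J)} = C₁θ_J`, depth-free
    have hL0 : (0 : ℝ) < F.L := by linarith
    have hNN : ((F.L : ℝ)⁻¹) ^ (2 * (K - J)) * (F.L : ℝ) ^ (2 * (K - J)) = 1 := by
      rw [← mul_pow, inv_mul_cancel₀ hL0.ne', one_pow]
    have hkey : C₁ * θJ * ((F.L : ℝ)⁻¹) ^ (2 * (K - J)) * (F.L : ℝ) ^ (2 * (K - J)) = C₁ * θJ := by
      rw [mul_assoc, hNN, mul_one]
    have hCθ : C₁ * θJ ≤ (C₁ + 1) * a₀ := by nlinarith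
    have hG' : ((((F.P K).d + 4) * (F.P K).L : ℕ) : ℝ) ^ 2 / 4 = Gc := by rw [hPd, hPL, hGc, hFL]
    have hsmall : 4 * (143 * (((((F.P K).d + 4) * (F.P K).L : ℕ) : ℝ) ^ 2 / 4) ^ 2) * (C₁ * θJ * ((F.L : ℝ)⁻¹) ^ (2 * (K - J))) *
        ((F.P K).L : ℝ) ^ (2 * (K - J)) ≤ ((F.P K).L : ℝ) ^ 2 - 1 := by
      rw [hG', hPL, mul_assoc (4 * (143 * Gc ^ 2)), hkey, hFL']
      have h1 : a₀ ≤ ((L : ℝ) ^ 2 - 1) / (4 * (143 * Gc ^ 2) * (C₁ + 1)) := by rw [ha₀]; exact min_le_left _ _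
      have h2 : 4 * (143 * Gc ^ 2) * (C₁ + 1) * a₀ ≤ (L : ℝ) ^ 2 - 1 := by
        have := mul_le_mul_of_nonneg_left h1 (by positivity : (0 : ℝ) ≤ 4 * (143 * Gc ^ 2) * (C₁ + 1))
        rwa [mul_div_cancel₀ _ (by positivity : (4 * (143 * Gc ^ 2) * (C₁ + 1) : ℝ) ≠ 0)] at this
      nlinarith [mul_le_mul_of_nonneg_left hCθ (by positivity : (0 : ℝ) ≤ 4 * (143 * Gc ^ 2))]
    have hguard : (((((F.P K).d + 4) * (F.P K).L : ℕ) : ℝ) ^ 2 / 4) * (2 * (C₁ * θJ * ((F.L : ℝ)⁻¹) ^ (2 * (K - J))) * ((F.P K).L : ℝ) ^ (2 * (K - J))) ≤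
        ExpMeanLog.deltaSU (Fin 2) / 2 := by
      rw [hG', hPL, mul_assoc 2, hkey]
      have h1 : a₀ ≤ ExpMeanLog.deltaSU (Fin 2) / 2 / (Gc * (2 * (C₁ + 1))) := by rw [ha₀]; exact min_le_right _ _
      have h2 : Gc * (2 * (C₁ + 1)) * a₀ ≤ ExpMeanLog.deltaSU (Fin 2) / 2 := by
        have := mul_le_mul_of_nonneg_left h1 (by positivity : (0 : ℝ) ≤ Gc * (2 * (C₁ + 1)))
        rwa [mul_div_cancel₀ _ (by positivity : (Gc * (2 * (C₁ + 1)) : ℝ) ≠ 0)] at this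
      nlinarith [mul_le_mul_of_nonneg_left hCθ (by positivity : (0 : ℝ) ≤ 2 * Gc)]
    have h := dist1_plaqHol_iter_le (P := F.P K) (m := K - J) hLF U₀ ha0' h0 hsmall hguard t ht p
    calc dist1 (GaugeField.plaqHol (Averaging.iter (fun k => blockAvg (P := F.P K) (j := k) ℰp) t U₀) p)
        ≤ 2 * (C₁ * θJ * ((F.L : ℝ)⁻¹) ^ (2 * (K - J))) * ((F.P K).L : ℝ) ^ (2 * t) := h
      _ = 2 * C₁ * θJ * (F.L : ℝ) ^ (2 * t) * ((F.L : ℝ)⁻¹) ^ (2 * (K - J)) := by rw [hPL]; ring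
  · exact ⟨γ₁, hγ₁, C₁, hC₁, fun F γ hFL => absurd (hFL ▸ F.hL.2) hL⟩

end Summit.QuantumFields.YangMills.Theorems.FluctuationComparisonRegPrIntLS2BetaBackgroundTowerLetter

end
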